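import Literature.MathematicalPhysics.QuantumFieldTheory.Balaban1983to89.Node00.Record5
import Literature.MathematicalPhysics.QuantumFieldTheory.Balaban1983to89.B10CompactBinding

/-!
# NODE 00 (YM-PLAN Track A) — STAGE 5, THE BINDING OF RECORD: `IsRecordOfRecord₅C F N D w` — the Stage-5 record predicate whose upstream
# block is the C-BINDING `B10CompactBinding.ofPrintedAllXPNC` (the [Balaban1985UV3] leaf `b10` in the COMPACT reading; pub-ymgap chair R434
# (Q2) = (C)), over the SAME Stage-5 objects (`Stage5Params`, `Residual₅`, `machineOfRecord₅`, `datumOfRecord₅`) as `Node00.Record5`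

NODE 00 STAGE-5 MODULE, second file (seat `pub-ymgap-node00-def` g28, 2026-08-26; definition item `defn-IsRecordOfRecord₅`; APPEND-ONLY growth: a NEW
importing module, `Node00.Record5` untouched).  WHY A SECOND PREDICATE: `Node00.IsRecordOfRecord₅` (module `Record5`, landed) binds the world by the
N-binding `Upstream.ofPrintedAllXPN`, whose `b10` leaf is the LITERAL reading `B10.Thm1Printed X.runs10 ∧ B10.Thm2Printed X.runs10` — on fine-lattice
run families that reading makes `Dag.B10_main` equivalent to the failure of its in-edges (`BalabanUVNodesN08Concrete.b10_main_allScales_iff_inEdge_fails`),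
so a record family built on it cannot carry the three paper clusters jointly; the chair's word of record (R434 (Q2) = (C), 2026-08-25) is that the
record predicate binds `w.up P = B10CompactBinding.ofPrintedAllXPNC (carriers₃ θ (X P)) (Y P) (Z P) (V P) (W P)` — the SAME binding with the ONE slot
`b10 := DagDischarged.b10Compact` ([Balaban1985UV3] Thm 1 with one constant per compact coupling window ∧ Thm 2).  This module is that predicate:
`IsRecordOfRecord₅C`, with `upOfRecord₅C θ P := withB10 (upOfRecord₅ θ P) (b10Compact …)`; every other leaf is the N-binding's (`rfl`), so the
Stage 1–3 node theorems (N01, N02, N04; N03 modulo the Prop. 2.6 census) transport along the literal re-binding `{w with up := upOfRecord₅ θ}`, which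
IS a world of record, Stage 3.  `IsRecordOfRecord₅` stays in the tree as the literal-`b10` twin (the documented negative edge's record form); the
two predicates agree on `D`, `w.C`, `w.γ`, `w.L` and on every leaf except `b10` (`isRecordOfRecord₅_rebind_of_isRecordOfRecord₅C` and conversely).
THE PREDICATE OF RECORD for the route «BalabanUVNodes» and for the refinements `₆ ₇ ₈ → ₅C` is `IsRecordOfRecord₅C`.
HONEST FRAMING: definitions + kernel bookkeeping; NO estimate, NO satisfiability claim (`stub_W00`); the residual objects of `Residual₅` are free DATA
here exactly as in `Record5` (the ∃-cruxes stay junk-inhabited until stage ₈ — director-ym LINE №17, n13-b's kernel probe); nothing of Bałaban's asserted;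
one finite T⁴ programme at fixed ε per run — NOT ℝ⁴ ∕ infinite volume ∕ OS ∕ mass gap ∕ Clay.
-/

noncomputable section

open MeasureTheory

namespace Literature.MathematicalPhysics.QuantumFieldTheory.Balaban1983to89.Node00

open T4Continuum AveragingRT T4FiniteEpsInhabited FlowStep FlowStepRuns DagBinding T4DatumAssembly
open B6KLevelCensusIndexV1 (KIdx kGeoG)
open B6Prop26Census2136KLevelV1 (kG)
open B10CompactBinding (withB10 ofPrintedAllXPNC)
open DagDischarged (b10Compact)

variable (F : T4Family) (N : ℕ) [NeZero N]

/-! ## §1. The C-binding over the Stage-5 carriers and the record predicate of record -/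

/-- **The upstream block of record at `θ` and the run `P`, C-BINDING**: the N-binding `upOfRecord₅ θ P` over the Stage-3 carriers of record and the
residual [B8]–[B16] carrier families with its `b10` slot := `DagDischarged.b10Compact` — i.e. `B10CompactBinding.ofPrintedAllXPNC (carriers₃ θ (X P)) (Y P)
(Z P) (V P) (W P)` (`upOfRecord₅C_eq`). [cite: Balaban1985UV3, Thm 1 p.257 (compact reading, cell GAPS G-B10-01) + Thm 2 p.272; Balaban1984PropagatorsII, pp.223–250 (the Stage-3 carriers of record)] -/
def upOfRecord₅C (θ : Stage5Params F N) (P : B12.RunParams) : Upstream :=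
  withB10 (upOfRecord₅ F N θ P) (b10Compact (carriers₃ θ.toStage3Params (θ.res.X P)).toPrintedCarriers)

/-- `upOfRecord₅C θ P` IS the C-binding `ofPrintedAllXPNC` over the record's carriers (`rfl`). [cite: Balaban1985UV3, Thm 1 p.257 (bookkeeping)] -/
theorem upOfRecord₅C_eq (θ : Stage5Params F N) (P : B12.RunParams) :
    upOfRecord₅C F N θ P =
      ofPrintedAllXPNC (carriers₃ θ.toStage3Params (θ.res.X P)) (θ.res.Y P) (θ.res.Z P) (θ.res.V P) (θ.res.W P) := rfl

/-- The `b10` leaf of the C-binding of record, unfolded: [Balaban1985UV3] Thm 1 in the compact reading ∧ Thm 2 over the (residual) run family of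
`carriers₃ θ (X P)` (`Iff.rfl`). [cite: Balaban1985UV3, Thm 1 p.257 (compact reading) + Thm 2 p.272] -/
theorem upOfRecord₅C_b10_iff (θ : Stage5Params F N) (P : B12.RunParams) :
    (upOfRecord₅C F N θ P).b10 ↔
      B10.Thm1PrintedCompact (carriers₃ θ.toStage3Params (θ.res.X P)).runs10 ∧
        B10.Thm2Printed (carriers₃ θ.toStage3Params (θ.res.X P)).runs10 := Iff.rfl

/-- Every leaf of the C-binding of record other than `b10` IS the N-binding's (`rfl` ×11). [cite: Balaban1985UV3, Thm 1 p.257 (bookkeeping: the re-binding touches `b10` only)] -/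
theorem upOfRecord₅C_leaves (θ : Stage5Params F N) (P : B12.RunParams) :
    (upOfRecord₅C F N θ P).b4 = (upOfRecord₅ F N θ P).b4 ∧ (upOfRecord₅C F N θ P).b5 = (upOfRecord₅ F N θ P).b5 ∧
    (upOfRecord₅C F N θ P).b6 = (upOfRecord₅ F N θ P).b6 ∧ (upOfRecord₅C F N θ P).b7 = (upOfRecord₅ F N θ P).b7 ∧
    (upOfRecord₅C F N θ P).b8 = (upOfRecord₅ F N θ P).b8 ∧ (upOfRecord₅C F N θ P).b9 = (upOfRecord₅ F N θ P).b9 ∧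
    (upOfRecord₅C F N θ P).b11 = (upOfRecord₅ F N θ P).b11 ∧ (upOfRecord₅C F N θ P).b12 = (upOfRecord₅ F N θ P).b12 ∧
    (upOfRecord₅C F N θ P).b13 = (upOfRecord₅ F N θ P).b13 ∧ (upOfRecord₅C F N θ P).rOperation = (upOfRecord₅ F N θ P).rOperation ∧
    (upOfRecord₅C F N θ P).rBasicStep = (upOfRecord₅ F N θ P).rBasicStep :=
  ⟨rfl, rfl, rfl, rfl, rfl, rfl, rfl, rfl, rfl, rfl, rfl⟩

/-- **«(D, w) is the record, Stage 5» — THE RECORD PREDICATE OF RECORD** (C-binding; pub-ymgap chair R434 (Q2) = (C)): for SOME admissible Stage-5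
parameters `θ`, the datum IS the assembled datum of record at `θ`, the world's construction IS the datum's, its interval constant is `θ.γ`, its block size
is Bałaban's `L`, and at every run its upstream block is the C-binding of record at `θ`.  Shape `YMDAG.UVSplit.RecordPred N` up to the order of `F`, `N`.
[cite: Balaban1988Convergent, (0.2) p.244; Balaban1989LargeFieldII, Thm 1 + (0.1) pp.355–356; Balaban1987RG1, (0.17)–(0.20) pp.255–256; Balaban1985UV3, Thm 1 p.257 (compact reading) (objects of record, Stage 5 dictionary, binding of record)] -/
def IsRecordOfRecord₅C (D : FiniteEpsData F (SU N)) (w : WorldP) : Prop :=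
  ∃ θ : Stage5Params F N, θ.Admissible ∧ D = datumOfRecord₅ F N θ ∧ w.C = D.C ∧ w.γ = θ.γ ∧ w.L = (θ.L : ℝ) ∧
    ∀ P : B12.RunParams, w.up P = upOfRecord₅C F N θ P

/-! ## §2. What the record predicate forces (kernel bookkeeping; no estimate) -/

section Consequences

variable {F N}
variable {D : FiniteEpsData F (SU N)} {w : WorldP}

/-- **The literal re-binding of a Stage-5 record's world is a world of record, Stage 3** (hence 2, 1), and a Stage-5 record in the sense of `Record5`:
replacing `w.up` by the N-binding `upOfRecord₅ θ` over the SAME carriers. [cite: Balaban1984PropagatorsII, pp.223–250 (bookkeeping)] -/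
theorem rebind_of_isRecordOfRecord₅C (h : IsRecordOfRecord₅C F N D w) :
    ∃ θ : Stage5Params F N, θ.Admissible ∧ (∀ P, w.up P = upOfRecord₅C F N θ P) ∧
      IsWorldOfRecord₃ { w with up := upOfRecord₅ F N θ } ∧ IsRecordOfRecord₅ F N D { w with up := upOfRecord₅ F N θ } := by
  obtain ⟨θ, hθ, hD, hC, hγ, hL, hup⟩ := h
  exact ⟨θ, hθ, hup, ⟨θ.toStage3Params, hθ.1, fun P => ⟨θ.res.X P, θ.res.Y P, θ.res.Z P, θ.res.V P, θ.res.W P, rfl⟩⟩,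
    θ, hθ, hD, hC, hγ, hL, fun _ => rfl⟩

/-- Conversely, re-binding a `Record5` record's world by the C-binding over the same carriers gives a record in the sense of this module.
[cite: Balaban1985UV3, Thm 1 p.257 (the two readings; bookkeeping)] -/
theorem isRecordOfRecord₅C_rebind_of_isRecordOfRecord₅ (h : IsRecordOfRecord₅ F N D w) :
    ∃ θ : Stage5Params F N, θ.Admissible ∧ (∀ P, w.up P = upOfRecord₅ F N θ P) ∧
      IsRecordOfRecord₅C F N D { w with up := upOfRecord₅C F N θ } := by
  obtain ⟨θ, hθ, hD, hC, hγ, hL, hup⟩ := h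
  exact ⟨θ, hθ, hup, θ, hθ, hD, hC, hγ, hL, fun _ => rfl⟩

/-- A Stage-5 record's datum is a datum of record, Stage 0. [cite: Balaban1987RG1, (0.3)–(0.4) p.253 (bookkeeping)] -/
theorem isDatumOfRecord₀_of_isRecordOfRecord₅C (h : IsRecordOfRecord₅C F N D w) : IsDatumOfRecord₀ F N D := by
  obtain ⟨θ, -, rfl, -⟩ := h
  exact isDatumOfRecord₀_datumOfRecord F N _

/-- Binding half, clause 1: the world's construction IS the datum's. [cite: Balaban1989LargeFieldII, Thm 1 p.355 (bookkeeping)] -/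
theorem construction_eq_of_isRecordOfRecord₅C (h : IsRecordOfRecord₅C F N D w) : w.C = D.C := h.choose_spec.2.2.1

/-- Binding half, clause 2: the interval constant is positive. [cite: Balaban1989LargeFieldII, Thm 1 p.355 (bookkeeping)] -/
theorem gamma_pos_of_isRecordOfRecord₅C (h : IsRecordOfRecord₅C F N D w) : 0 < w.γ := by
  obtain ⟨θ, hθ, -, -, hγ, -⟩ := h
  rw [hγ]; exact hθ.2

/-- The construction of a Stage-5 record is the ASSEMBLED construction at the machine of the record and the averaging of record.
[cite: Balaban1988Convergent, (0.2) p.244 (bookkeeping)] -/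
theorem construction_eq_assembled_of_isRecordOfRecord₅C (h : IsRecordOfRecord₅C F N D w) :
    ∃ θ : Stage5Params F N, θ.Admissible ∧ w.γ = θ.γ ∧
      w.C = (machineOfRecord₅ F N θ).construction (avOfRecord F N) := by
  obtain ⟨θ, hθ, rfl, hC, hγ, -, -⟩ := h
  exact ⟨θ, hθ, hγ, hC⟩

/-- **Binding half, clause 3 — GUARDED (0.20)** at every Stage-5 record: along every run whose couplings stay in `]0, w.γ]` the flow satisfies (0.20)
— NO input (`T4DatumAssembly.RGMachine.satisfiesRG_construction`). [cite: Balaban1987RG1, (0.20) p.256] -/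
theorem rgFlow_of_smallCouplings_of_isRecordOfRecord₅C (h : IsRecordOfRecord₅C F N D w) (P : B12.RunParams)
    (hsc : (leavesP w P).smallCouplings) : (leavesP w P).rgFlow := by
  obtain ⟨θ, -, -, hC⟩ := construction_eq_assembled_of_isRecordOfRecord₅C h
  show (w.C P).flow.SatisfiesRG P.K
  have hsc' : (w.C P).flow.InInterval w.γ P.K := hsc
  rw [hC] at hsc' ⊢
  exact RGMachine.satisfiesRG_construction _ _ P hsc'

/-- **Binding half, clause 3 — UNGUARDED (0.20)** at a Stage-5 record from «the residual β-functions never overshoot» (`RGMachine.rgFlow_of_noOvershoot`).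
[cite: Balaban1987RG1, (0.18)–(0.20) pp.255–256] -/
theorem rgFlow_of_noOvershoot_of_isRecordOfRecord₅C (h : IsRecordOfRecord₅C F N D w)
    (hno : ∀ θ : Stage5Params F N, θ.Admissible → ∀ (p : B12.RunParams) (k : ℕ), k < p.K →
      θ.res.βfun k (prefixOf (genSeq θ.res.βfun p.g0) k) ≤ 1 / (genSeq θ.res.βfun p.g0 k) ^ 2)
    (P : B12.RunParams) : (leavesP w P).rgFlow := by
  obtain ⟨θ, hθ, -, hC⟩ := construction_eq_assembled_of_isRecordOfRecord₅C h
  exact RGMachine.rgFlow_of_noOvershoot _ _ w hC (hno θ hθ) P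

/-- The β-window binder at a Stage-5 record from BOX BOUNDS of the residual β-functions (`RGMachine.betaBoundsInInterval_construction`); both bounds
DISPLAYED, neither assumed. [cite: Balaban1987RG1, (1.22) p.264] -/
theorem betaBoundsInInterval_of_boxBounds_of_isRecordOfRecord₅C (h : IsRecordOfRecord₅C F N D w) {γ₀ b βup : ℝ}
    (hbox : ∀ θ : Stage5Params F N, θ.Admissible → BetaLowerH b γ₀ θ.res.βfun ∧ BetaUpperH βup γ₀ θ.res.βfun) :
    BetaBoundsInInterval w.C.toB12 γ₀ b βup := by
  obtain ⟨θ, hθ, -, hC⟩ := construction_eq_assembled_of_isRecordOfRecord₅C h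
  rw [hC]
  exact RGMachine.betaBoundsInInterval_construction _ _ (hbox θ hθ).1 (hbox θ hθ).2

/-- **At a Stage-5 record the END headline needs NO `rgFlow` binder**: nodes at every run + the β-window binder ⇒ `B16.EndStatementBPrinted D.C`
(`endStatementBPrinted_of_nodesP_interval_guarded` with the record's guarded (0.20), `0 < γ`, `w.C = D.C`). [cite: Balaban1989LargeFieldII, Thm 1 p.355 + p.391] -/
theorem endStatementBPrinted_of_isRecordOfRecord₅C_of_nodes (h : IsRecordOfRecord₅C F N D w) {γ₀ : ℝ} (hγ₀ : w.γ ≤ γ₀)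
    (hnodes : ∀ P, Nodes (leavesP w P)) (hβ : BetaBoundsInInterval w.C.toB12 γ₀ w.b w.βup) :
    B16.EndStatementBPrinted D.C := by
  rw [← construction_eq_of_isRecordOfRecord₅C h]
  exact endStatementBPrinted_of_nodesP_interval_guarded w (gamma_pos_of_isRecordOfRecord₅C h) hγ₀ hnodes
    (rgFlow_of_smallCouplings_of_isRecordOfRecord₅C h) hβ

/-- N01 · `Dag.B4_main` at every run of every Stage-5 record: the leaf `b4` of the C-binding is the N-binding's (`rfl`), where it is the Stage-3 theorem
`b4_main_of_isWorldOfRecord₃` at the literal re-binding. [cite: Balaban1983RegularityDecay, Theorem p.573 (kernel version of the lit-balaban r01 lineage)] -/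
theorem b4_main_of_isRecordOfRecord₅C (h : IsRecordOfRecord₅C F N D w) (P : B12.RunParams) : Dag.B4_main (leavesP w P) := by
  obtain ⟨θ, -, hup, h3, -⟩ := rebind_of_isRecordOfRecord₅C h
  have h4 := b4_main_of_isWorldOfRecord₃ _ h3 P
  show (w.up P).b4
  rw [hup P]
  exact h4

/-- N02 · `Dag.B5_main` at every run of every Stage-5 record (leaves `b4`, `b5` of the C-binding are the N-binding's). [cite: Balaban1984PropagatorsI, Props. 1.1–1.2 pp.33–36 (kernel versions of the lit-balaban lineages)] -/
theorem b5_main_of_isRecordOfRecord₅C (h : IsRecordOfRecord₅C F N D w) (P : B12.RunParams) : Dag.B5_main (leavesP w P) := by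
  obtain ⟨θ, -, hup, h3, -⟩ := rebind_of_isRecordOfRecord₅C h
  have h5 := b5_main_of_isWorldOfRecord₃ _ h3 P
  show (w.up P).b4 → (w.up P).b5
  rw [hup P]
  exact h5

/-- N04 · `Dag.B7_main` at every run of every Stage-5 record (leaves `b5`, `b7` of the C-binding are the N-binding's; cf. `B10CompactBinding.b7_main_of_upC`).
[cite: Balaban1985Averaging, Props. 1–10 pp.26–50 (kernel version of the lit-balaban lineage)] -/
theorem b7_main_of_isRecordOfRecord₅C (h : IsRecordOfRecord₅C F N D w) (P : B12.RunParams) : Dag.B7_main (leavesP w P) := by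
  obtain ⟨θ, -, hup, h3, -⟩ := rebind_of_isRecordOfRecord₅C h
  have h7 := b7_main_of_isWorldOfRecord₃ _ h3 P
  show (w.up P).b5 → (w.up P).b7
  rw [hup P]
  exact h7

/-- N03 · `Dag.B6_main` at every run of every Stage-5 record MODULO EXACTLY the Prop. 2.6 census (`Carriers3Leaf`; leaves `b4`, `b5`, `b6` of the C-binding are
the N-binding's). [cite: Balaban1984PropagatorsII, Lemma 2.1 – Cor. 2.8 pp.234–249 (the stated block at the objects of record)] -/
theorem b6_main_of_isRecordOfRecord₅C_of_prop26
    (h26 : ∀ θ : Stage3Params, θ.toStage1Params.Admissible →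
      B6.Prop26Printed (fun i : KIdx θ.d₆ θ.ℓ₆ θ.hd' θ.hL' θ.b₀ θ.b₁ => kGeoG i) (fun i => kG i))
    (h : IsRecordOfRecord₅C F N D w) (P : B12.RunParams) : Dag.B6_main (leavesP w P) := by
  obtain ⟨θ, -, hup, h3, -⟩ := rebind_of_isRecordOfRecord₅C h
  have h6 := b6_main_of_isWorldOfRecord₃_of_prop26 h26 _ h3 P
  show (w.up P).b4 → (w.up P).b5 → (w.up P).b6
  rw [hup P]
  exact h6

/-- N23 · binder B1 at every Stage-5 record: the datum is printed-averaged. [cite: Balaban1987RG1, (0.4) p.253] -/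
theorem isPrintedAveraged_of_isRecordOfRecord₅C (h : IsRecordOfRecord₅C F N D w) : D.IsPrintedAveraged :=
  isPrintedAveraged_of_isDatumOfRecord₀ F N D (isDatumOfRecord₀_of_isRecordOfRecord₅C h)

end Consequences

/-- **The constant-binding records** (C-binding): for admissible `θ`, the assembled datum and any world re-bound to its construction, `θ.γ`, `θ.L` and the
C-binding of record form a Stage-5 record. [cite: Balaban1989LargeFieldII, Thm 1 + (0.1) pp.355–356 (objects of record, bookkeeping)] -/
theorem isRecordOfRecord₅C_of_eq (θ : Stage5Params F N) (hθ : θ.Admissible) (w : WorldP)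
    (hC : w.C = (datumOfRecord₅ F N θ).C) (hγ : w.γ = θ.γ) (hL : w.L = (θ.L : ℝ))
    (hup : ∀ P, w.up P = upOfRecord₅C F N θ P) : IsRecordOfRecord₅C F N (datumOfRecord₅ F N θ) w :=
  ⟨θ, hθ, rfl, hC, hγ, hL, hup⟩

end Literature.MathematicalPhysics.QuantumFieldTheory.Balaban1983to89.Node00

end
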